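import Summits.Ventures.HodgeRepro2.PeterssonInner
import Summits.Ventures.HodgeRepro2.BallQuotientMeasure

/-!
# The Petersson inner product through a fundamental domain

Kernel support for the blind cell pub-hodge-repro2 (seat p2), T5-ID §ID-4(b′) — the assembly of rows 96
(`PeterssonInner.lean`: the inner product against an abstract measure on `Γ\𝔹²`) and 99
(`BallQuotientMeasure.lean`: the quotient measure constructed from the Bergman measure through a
fundamental domain `D`):

* `⟨f, g⟩_{quotientMeasure D} = ∫_D f \overline{g} (1 − ‖z‖²)^k dμ_B` — the classical formula;
* the value does not depend on the choice of the fundamental domain (the integrand is `S`-invariant);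
* **positive definiteness under the arithmetic hypothesis alone**: if `D` is a measurable fundamental
  domain of finite Bergman measure and `Γ\𝔹²` is compact, then `⟨f, f⟩ > 0` for every continuous
  weight-`k` form `f` not vanishing identically on the ball, and `⟨f, f⟩ = 0 ⟺ f ≡ 0` on `𝔹²`.
-/

namespace Summit.Ventures.HodgeRepro2.ShimuraData

open MeasureTheory
open scoped Pointwise

variable {K : Type*} [Field K] [NumberField K] [NumberField.IsCMField K]
    {τ₁ : K →+* ℂ} {H : Matrix (Fin 3) (Fin 3) K} {Q : Matrix (Fin 3) (Fin 3) ℂ}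
    (hQ : IsFrame K τ₁ H Q) (S : Subgroup (GL (Fin 3) K)) (hS : (S : Set (GL (Fin 3) K)) ⊆ unitaryGroup K H)

/-- The descended density is measurable on `Γ\𝔹²` (it is continuous). -/
theorem aestronglyMeasurable_peterssonPairQuotient (D : Set ball₂) {k : ℕ} {f g : (Fin 2 → ℂ) → ℂ}
    (hf : IsWeightFor τ₁ Q S k f) (hg : IsWeightFor τ₁ Q S k g) (hfc : ContinuousOn f ball₂)
    (hgc : ContinuousOn g ball₂) :
    AEStronglyMeasurable (peterssonPairQuotient hQ S hS hf hg) (quotientMeasure hQ S hS D) :=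
  (continuous_peterssonPairQuotient hQ S hS hf hg hfc hgc).aestronglyMeasurable

/-- **The Petersson inner product is an integral over the fundamental domain**:
`⟨f, g⟩ = ∫_D f(z) \overline{g(z)} (1 − ‖z‖²)^k dμ_B(z)`. -/
theorem peterssonInner_quotientMeasure (D : Set ball₂) {k : ℕ} {f g : (Fin 2 → ℂ) → ℂ}
    (hf : IsWeightFor τ₁ Q S k f) (hg : IsWeightFor τ₁ Q S k g) (hfc : ContinuousOn f ball₂)
    (hgc : ContinuousOn g ball₂) :
    peterssonInner hQ S hS (quotientMeasure hQ S hS D) hf hg =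
      ∫ z in D, peterssonPair k f g (z : Fin 2 → ℂ) ∂bergmanBall := by
  unfold peterssonInner
  rw [integral_quotientMeasure hQ S hS D
    (aestronglyMeasurable_peterssonPairQuotient hQ S hS D hf hg hfc hgc)]
  simp only [peterssonPairQuotient_mk]

/-- The integrand is `S`-invariant on the ball (pointwise form on the subtype). -/
theorem peterssonPair_smul {k : ℕ} {f g : (Fin 2 → ℂ) → ℂ} (hf : IsWeightFor τ₁ Q S k f)
    (hg : IsWeightFor τ₁ Q S k g) (γ : S) (z : ball₂) :
    letI := frameAction hQ S hS
    peterssonPair k f g ((γ • z : ball₂) : Fin 2 → ℂ) = peterssonPair k f g (z : Fin 2 → ℂ) :=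
  peterssonPair_frameAction_smul hQ S hS hf hg γ z

/-- **Independence of the fundamental domain**: for two fundamental domains `D`, `D'`, the integrals of
the (S-invariant) Petersson density agree. -/
theorem setIntegral_peterssonPair_eq {D D' : Set ball₂} (hD : IsBallFundamentalDomain hQ S hS D)
    (hD' : IsBallFundamentalDomain hQ S hS D') {k : ℕ} {f g : (Fin 2 → ℂ) → ℂ}
    (hf : IsWeightFor τ₁ Q S k f) (hg : IsWeightFor τ₁ Q S k g) :
    ∫ z in D, peterssonPair k f g (z : Fin 2 → ℂ) ∂bergmanBall =
      ∫ z in D', peterssonPair k f g (z : Fin 2 → ℂ) ∂bergmanBall := by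
  letI := frameAction hQ S hS
  haveI : MeasurableConstSMul S ball₂ := measurableConstSMul_frameAction hQ S hS
  haveI : SMulInvariantMeasure S ball₂ bergmanBall := smulInvariantMeasure_bergmanBall hQ S hS
  haveI : Countable S := countable_subgroup_GL_of_numberField S
  exact hD.setIntegral_eq hD' (fun γ z => peterssonPair_smul hQ S hS hf hg γ z)

/-- The Petersson inner product does not depend on the fundamental domain used to build the quotient
measure. -/
theorem peterssonInner_quotientMeasure_eq {D D' : Set ball₂} (hD : IsBallFundamentalDomain hQ S hS D)
    (hD' : IsBallFundamentalDomain hQ S hS D') {k : ℕ} {f g : (Fin 2 → ℂ) → ℂ}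
    (hf : IsWeightFor τ₁ Q S k f) (hg : IsWeightFor τ₁ Q S k g) (hfc : ContinuousOn f ball₂)
    (hgc : ContinuousOn g ball₂) :
    peterssonInner hQ S hS (quotientMeasure hQ S hS D) hf hg =
      peterssonInner hQ S hS (quotientMeasure hQ S hS D') hf hg := by
  rw [peterssonInner_quotientMeasure hQ S hS D hf hg hfc hgc,
    peterssonInner_quotientMeasure hQ S hS D' hf hg hfc hgc,
    setIntegral_peterssonPair_eq hQ S hS hD hD' hf hg]

section Positivity

variable [CompactSpace (ballQuotient hQ S hS)] {D : Set ball₂}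

/-- **Positivity of the Petersson norm on the compact quotient, from the arithmetic hypothesis alone**:
`D` a measurable fundamental domain of finite Bergman measure, `Γ\𝔹²` compact; then for every continuous
weight-`k` form `f` with `f z₀ ≠ 0` at one point of the ball,
`∫_D |f|² (1 − ‖z‖²)^k dμ_B = ⟨f, f⟩ > 0`. -/
theorem peterssonInner_self_re_pos_quotientMeasure (hD : IsBallFundamentalDomain hQ S hS D)
    (hfin : bergmanBall D < ⊤) {k : ℕ} {f : (Fin 2 → ℂ) → ℂ} (hf : IsWeightFor τ₁ Q S k f) (hfc : ContinuousOn f ball₂) {z₀ : Fin 2 → ℂ} (hz₀ : z₀ ∈ ball₂)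
    (hne : f z₀ ≠ 0) :
    0 < (peterssonInner hQ S hS (quotientMeasure hQ S hS D) hf hf).re := by
  haveI := isOpenPosMeasure_quotientMeasure hQ S hS hD
  haveI := isFiniteMeasure_quotientMeasure hQ S hS D hfin
  exact peterssonInner_self_re_pos hQ S hS (quotientMeasure hQ S hS D) hf hfc hz₀ hne

/-- **Non-degeneracy from the arithmetic hypothesis alone**: `⟨f, f⟩ = 0 ⟺ f ≡ 0` on the ball. -/
theorem peterssonInner_self_eq_zero_iff_quotientMeasure (hD : IsBallFundamentalDomain hQ S hS D)
    (hfin : bergmanBall D < ⊤) {k : ℕ} {f : (Fin 2 → ℂ) → ℂ} (hf : IsWeightFor τ₁ Q S k f) (hfc : ContinuousOn f ball₂) :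
    peterssonInner hQ S hS (quotientMeasure hQ S hS D) hf hf = 0 ↔ ∀ z ∈ ball₂, f z = 0 := by
  haveI := isOpenPosMeasure_quotientMeasure hQ S hS hD
  haveI := isFiniteMeasure_quotientMeasure hQ S hS D hfin
  exact peterssonInner_self_eq_zero_iff hQ S hS (quotientMeasure hQ S hS D) hf hfc

/-- The same, as a statement about the integral over the fundamental domain: the Petersson norm
`∫_D |f|² (1 − ‖z‖²)^k dμ_B` of a continuous weight-`k` form vanishes iff `f ≡ 0` on the ball. -/
theorem setIntegral_peterssonPair_self_eq_zero_iff (hD : IsBallFundamentalDomain hQ S hS D)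
    (hfin : bergmanBall D < ⊤) {k : ℕ} {f : (Fin 2 → ℂ) → ℂ} (hf : IsWeightFor τ₁ Q S k f) (hfc : ContinuousOn f ball₂) :
    ∫ z in D, peterssonPair k f f (z : Fin 2 → ℂ) ∂bergmanBall = 0 ↔ ∀ z ∈ ball₂, f z = 0 := by
  rw [← peterssonInner_quotientMeasure hQ S hS D hf hf hfc hfc]
  exact peterssonInner_self_eq_zero_iff_quotientMeasure hQ S hS hD hfin hf hfc

end Positivity

end Summit.Ventures.HodgeRepro2.ShimuraData
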